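import Summits.QuantumFields.BalabanUV.Beta.CombHId2Letters
import Summits.QuantumFields.BalabanUV.Beta.CombHId2Product

/-!
# `BalabanUV.Beta.CombHId2CopySum` — binder row D1 (OWNER an2), (J-a) dictionary, (C2) at ORDER 2, part TWO-b (letters): **FAMILIES OF
# BI-LOCALISED KERNELS WITH SUMMABLE CONSTANTS** (the second bond's period copies `n ↦ X b (b′ + M′∘n)` of a two-insertion word) — their pointwise
# sum is bi-localised, `dper` and the sandwich `K ∘ · ∘ K` pass through `Σ'_n` —, **AND THE PERIOD COVARIANCE OF `dM` ∕ `K2OfK` IN THE BOND**: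
# `dM K N S Mt μ (y + M′∘n) = shiftK (−M∘n) (dM K N S Mt μ y)` for `M = N·M′`, `K` fine-period invariant, `S`, `Mt` period covariant

WHY.  The door binds a level-`j` second-order table `X b b′` on the torus as `perF M′ (dper M′ (x z ↦ Σ'_n X b (b′ + M′∘n) x z))` — the SECOND bond's period copies
summed pointwise, then the diagonal periodisation (U21's `hW₂₂` shape).  For `K3OfK`'s three words the copies are either translates of ONE bi-localised kernel (the
`dM ∕ K2OfK` words, by the covariance below — C3b's `tsum_dper_comp_translate` then applies) or a genuinely `n`-dependent far-small family (the `W` word — the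
letters of §1 apply).  This file holds the [folklore] letters; the words are assembled in `CombHId2Periodised`.
WHAT (0 `def`, 0 cited fact, 0 `def … : Prop`, 0 sorry; the family hypothesis is `|T n x z a b| ≤ g n · e^{−δ(|x−p|₁+|z−p|₁)}` with `g ≥ 0` summable):
§1 `summable_family_apply`, `biLoc_tsum_family`, `prodBound_dper_family`, **`dper_tsum_family`** (`dper M (Σ'_n T n) = Σ'_n dper M (T n)` pointwise) +
`summable_dper_family`, **`tsum_sandwich_family`** (`Σ'_n K ∘ T n ∘ K = K ∘ (Σ'_n T n) ∘ K` pointwise, `K` decaying); §2 `dper_shiftK_per` (`dper` forgets a period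
shift), `comp_shiftK_of_inv`, `comp_shiftK_left'`; §3 (`M = N·M′`) `nsmul_per`, `neg_nsmul_per`, `shiftK_per_of_inv`, `table_per_of_cov`, `ctable_per_of_cov`, **`dM_translate_per`**,
**`K2OfK_translate_per`** (the bond moved by a coarse period = the kernel shifted by the fine period; `SecondOrderResponse.vertexOfK∕M_shiftK_translate₂` BY NAME).
NOT HERE: the words, `K3OfK`, `e4OfKW` (→ `CombHId2Periodised`); nothing of Bałaban's asserted; NOT D1, NEVER «G-an2-4 closed», NOT BetaPertH, NOT continuum, NOT Clay.

HONEST DEPENDENCY (page 1, mandatory): continuum YM on T⁴ ⇐ BetaPertH ∧ nine spine estimates (0/9 proved); BetaPertH ⇐ (D1) ∧ (D4) ∧ CAP+tail;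
G-an2-4 gates asym, D1 and NE2/3/4.  HONEST FRAMING (cell contract, verbatim): «discharging `BetaPertH` makes Bałaban's UV stability UNCONDITIONAL —
a real constructive-QFT result; it is NOT the continuum limit and NOT the Clay problem.»  ABSOLUTE RULE (cell charter, verbatim): «No internally-minted
statement may enter as a cited fact. Every hypothesis is either kernel-proved in this package or a verbatim quotation of a PUBLISHED theorem with page
reference. The manuscript(s) under audit are NOT citable for their own disputed steps — they are the thing under adjudication; programme-internal
(2001/route/tribunal) claims are never citable.»  Row D1 OWNER an2 (b2b-balaban-beta-an2) gen 44, 2026-08-23; over C3a∕C3b and `KernelWard`'s Fubini bricks BY NAME.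
-/

noncomputable section

open scoped BigOperators

namespace Summit.QuantumFields.BalabanUV.Beta.CombHId2CopySum

open Literature.MathematicalPhysics.QuantumFieldTheory.Balaban1983to89
open Literature.MathematicalPhysics.QuantumFieldTheory.Balaban1983to89.Beta
open B12Sec2to5 (l1 l1_nonneg)
open B4TorusKernel.MultiPeriod (translate translate_apply)
open B4Reflection242 (translate_translate)
open B4Sect5Proof (latticeConst latticeConst_nonneg)
open ExpKernelCalculus (MKer Decays BiLoc comp shiftK comp_shiftK Zl Zl_nonneg summable_exp_shift summable_exp_shift')
open AffineAveraging (Site)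
open OneStepResolventKernel (Fib decays_mono biLoc_mono)
open OneStepKernelFamily (vertexOfK)
open SecondOrderResponse (vertexOfM dM K2OfK dM_apply vertexOfK_shiftK_translate₂ vertexOfM_shiftK_translate₂)
open KernelWard (ProdBound tsum_comm_of_prodBound)
open Summit.QuantumFields.BalabanUV.Beta.FP.KernelPeriodisationFib (translate_eq_add)
open Summit.QuantumFields.BalabanUV.Beta.FP.KernelPeriodisationFibLoc (dper dper_apply dper_translate summable_exp_l1_translate shiftK_eq_translate)
open Summit.QuantumFields.BalabanUV.Beta.CombHId1Sandwich (shiftK_of_translate_inv)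

variable {d : ℕ} (M : Fin (d + 1) → ℕ) [∀ μ, NeZero (M μ)]

/-! ## §1 Families of bi-localised kernels with summable constants -/

section Family

variable {T : Site (d + 1) → MKer (d + 1) (Fib d)} {p : Site (d + 1)} {g : Site (d + 1) → ℝ} {δ : ℝ}

omit [∀ μ, NeZero (M μ)] in
/-- [folklore] a family bounded by `g n · e^{−δ(|x−p|₁+|z−p|₁)}` with `g` summable is pointwise summable in `n`. -/
theorem summable_family_apply (hT : ∀ n x z a b, |T n x z a b| ≤ g n * Real.exp (-δ * (l1 (x - p) + l1 (z - p)))) (hg : Summable g)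
    (x z : Site (d + 1)) (a b : Fib d) : Summable fun n => T n x z a b :=
  Summable.of_norm_bounded (hg.mul_right _) fun n => by rw [Real.norm_eq_abs]; exact hT n x z a b

omit [∀ μ, NeZero (M μ)] in
/-- [folklore] **the pointwise sum of such a family is bi-localised at `(p, p)`** with constant `Σ'_n g n` and the same rate. -/
theorem biLoc_tsum_family (hT : ∀ n x z a b, |T n x z a b| ≤ g n * Real.exp (-δ * (l1 (x - p) + l1 (z - p)))) (hg : Summable g) :
    BiLoc (fun x z a b => ∑' n, T n x z a b) p p (∑' n, g n) δ := by
  intro x z a b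
  have h := tsum_of_norm_bounded (hg.mul_right (Real.exp (-δ * (l1 (x - p) + l1 (z - p))))).hasSum
    fun n => by rw [Real.norm_eq_abs]; exact hT n x z a b
  rw [Real.norm_eq_abs, tsum_mul_right] at h
  exact h

/-- [folklore] the period-translates × copies double family `(m, n) ↦ T n (x + M∘m) (z + M∘m) a b` has a product majorant (`δ > 0`). -/
theorem prodBound_dper_family (hT : ∀ n x z a b, |T n x z a b| ≤ g n * Real.exp (-δ * (l1 (x - p) + l1 (z - p)))) (hg : Summable g)
    (hg0 : ∀ n, 0 ≤ g n) (hδ : 0 < δ) (x z : Site (d + 1)) (a b : Fib d) :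
    ProdBound fun m n => T n (translate M x m) (translate M z m) a b := by
  refine ⟨fun m => Real.exp (-δ * l1 (translate M x m - p)), g, (summable_exp_l1_translate M hδ p x).1, hg,
    fun m => (Real.exp_pos _).le, hg0, fun m n => ?_⟩
  refine (hT n _ _ a b).trans ?_
  rw [mul_add, Real.exp_add, mul_comm (g n)]
  have h1 : Real.exp (-δ * l1 (translate M z m - p)) ≤ 1 := by
    rw [Real.exp_le_one_iff]; exact mul_nonpos_of_nonpos_of_nonneg (neg_nonpos.2 hδ.le) (l1_nonneg _)
  calc Real.exp (-δ * l1 (translate M x m - p)) * Real.exp (-δ * l1 (translate M z m - p)) * g n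
      ≤ Real.exp (-δ * l1 (translate M x m - p)) * 1 * g n :=
        mul_le_mul_of_nonneg_right (mul_le_mul_of_nonneg_left h1 (Real.exp_pos _).le) (hg0 n)
    _ = Real.exp (-δ * l1 (translate M x m - p)) * g n := by rw [mul_one]

/-- [folklore] **`dper` PASSES THROUGH THE COPY SUM**: `dper M (x z ↦ Σ'_n T n x z) x z a b = Σ'_n dper M (T n) x z a b` (Fubini on the product majorant). -/
theorem dper_tsum_family (hT : ∀ n x z a b, |T n x z a b| ≤ g n * Real.exp (-δ * (l1 (x - p) + l1 (z - p)))) (hg : Summable g)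
    (hg0 : ∀ n, 0 ≤ g n) (hδ : 0 < δ) (x z : Site (d + 1)) (a b : Fib d) :
    dper M (fun x z a b => ∑' n, T n x z a b) x z a b = ∑' n, dper M (T n) x z a b := by
  simp only [dper_apply]
  exact tsum_comm_of_prodBound (prodBound_dper_family M hT hg hg0 hδ x z a b)

/-- [folklore] … and `n ↦ dper M (T n) x z a b` is summable (bounded by `(Σ'_m e^{−δ|x+M∘m−p|₁}) · g n`). -/
theorem summable_dper_family (hT : ∀ n x z a b, |T n x z a b| ≤ g n * Real.exp (-δ * (l1 (x - p) + l1 (z - p)))) (hg : Summable g)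
    (hg0 : ∀ n, 0 ≤ g n) (hδ : 0 < δ) (x z : Site (d + 1)) (a b : Fib d) :
    Summable fun n => dper M (T n) x z a b := by
  obtain ⟨φ, ψ, hφ, hψ, hφ0, -, hle⟩ := prodBound_dper_family M hT hg hg0 hδ x z a b
  refine Summable.of_norm_bounded (hψ.mul_left (∑' m, φ m)) fun n => ?_
  rw [Real.norm_eq_abs, dper_apply]
  have h := tsum_of_norm_bounded (hφ.mul_right (ψ n)).hasSum fun m => by rw [Real.norm_eq_abs]; exact hle m n
  rw [Real.norm_eq_abs, tsum_mul_right] at h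
  exact h

/-- [folklore] **THE SANDWICH PASSES THROUGH THE COPY SUM**: for `K` decaying (rate `δK > 0`) and the family as above with `δ > 0`,
`Σ'_n (K ∘ T n ∘ K) x z a b = (K ∘ (x z ↦ Σ'_n T n x z) ∘ K) x z a b` — two dominated exchanges (`KernelWard.tsum_comm_of_prodBound`). -/
theorem tsum_sandwich_family {K : MKer (d + 1) (Fib d)} {CK δK : ℝ} (hK : Decays K CK δK) (hδK : 0 < δK)
    (hT : ∀ n x z a b, |T n x z a b| ≤ g n * Real.exp (-δ * (l1 (x - p) + l1 (z - p)))) (hg : Summable g) (hg0 : ∀ n, 0 ≤ g n)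
    (hδ : 0 < δ) (x z : Site (d + 1)) (a b : Fib d) :
    ∑' n, comp (comp K (T n)) K x z a b = comp (comp K (fun x z a b => ∑' n, T n x z a b)) K x z a b := by
  have hCK : 0 ≤ CK := hK.nonneg (Sum.inl 0)
  have hTn : ∀ n, BiLoc (T n) p p (g n) δ := fun n x z a b => hT n x z a b
  -- common rate
  set r : ℝ := min δK δ with hr
  have hr0 : 0 < r := lt_min hδK hδ
  have hKr : Decays K CK r := decays_mono hK hCK le_rfl (min_le_left _ _)
  have hTr : ∀ n, BiLoc (T n) p p (g n) r := fun n => biLoc_mono (hTn n) (hg0 n) (min_le_right _ _)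
  -- the inner exchange, at every `(w, c)`: `Σ'_v Σ_f K x v a f · (Σ'_n T n v w f c) = Σ'_n (K ∘ T n) x w a c`
  have inner : ∀ (w : Site (d + 1)) (c : Fib d),
      (∑' v, ∑ f, K x v a f * (∑' n, T n v w f c)) = ∑' n, comp K (T n) x w a c := by
    intro w c
    have hPB : ProdBound fun v n => ∑ f, K x v a f * T n v w f c := by
      refine ⟨fun v => (Fintype.card (Fib d) : ℝ) * CK * Real.exp (-δK * l1 (x - v)), g, (summable_exp_shift hδK x).mul_left _, hg,
        fun v => by positivity, hg0, fun v n => ?_⟩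
      calc |∑ f, K x v a f * T n v w f c| ≤ ∑ f, |K x v a f * T n v w f c| := Finset.abs_sum_le_sum_abs _ _
        _ ≤ ∑ _f : Fib d, CK * Real.exp (-δK * l1 (x - v)) * g n := Finset.sum_le_sum fun f _ => by
            rw [abs_mul]
            refine mul_le_mul (hK x v a f) ((hT n v w f c).trans ?_) (abs_nonneg _) (by positivity)
            have h1 : Real.exp (-δ * (l1 (v - p) + l1 (w - p))) ≤ 1 := by
              rw [Real.exp_le_one_iff]
              exact mul_nonpos_of_nonpos_of_nonneg (neg_nonpos.2 hδ.le) (add_nonneg (l1_nonneg _) (l1_nonneg _))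
            calc g n * Real.exp (-δ * (l1 (v - p) + l1 (w - p))) ≤ g n * 1 := mul_le_mul_of_nonneg_left h1 (hg0 n)
              _ = g n := mul_one _
        _ = (Fintype.card (Fib d) : ℝ) * CK * Real.exp (-δK * l1 (x - v)) * g n := by
            rw [Finset.sum_const, Finset.card_univ, nsmul_eq_mul]; ring
    have hs : ∀ v f, Summable fun n => K x v a f * T n v w f c := fun v f =>
      (summable_family_apply hT hg v w f c).mul_left _
    calc (∑' v, ∑ f, K x v a f * (∑' n, T n v w f c))
        = ∑' v, ∑' n, ∑ f, K x v a f * T n v w f c := by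
          refine tsum_congr fun v => ?_
          rw [Summable.tsum_finsetSum (fun f _ => hs v f)]
          exact Finset.sum_congr rfl fun f _ => tsum_mul_left.symm
      _ = ∑' n, ∑' v, ∑ f, K x v a f * T n v w f c := tsum_comm_of_prodBound hPB
      _ = ∑' n, comp K (T n) x w a c := rfl
  -- the outer exchange: `Σ'_w Σ_c (Σ'_n (K ∘ T n) x w a c) · K w z c b = Σ'_n ((K ∘ T n) ∘ K) x z a b`
  have hKT : ∀ n, BiLoc (comp K (T n)) p p ((Fintype.card (Fib d) : ℝ) * (CK * g n) * Zl (d + 1) (r - r / 2)) (r / 2) := fun n =>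
    ExpKernelCalculus.biLoc_comp_decays hKr (hTr n) (half_pos hr0).le (half_lt_self hr0)
  have hZ : 0 ≤ Zl (d + 1) (r - r / 2) := Zl_nonneg (by linarith)
  have hPB2 : ProdBound fun w n => ∑ c, comp K (T n) x w a c * K w z c b := by
    refine ⟨fun w => Real.exp (-(r / 2) * l1 (w - p)),
      fun n => ((Fintype.card (Fib d) : ℝ) * ((Fintype.card (Fib d) : ℝ) * CK * Zl (d + 1) (r - r / 2)) * CK) * g n,
      summable_exp_shift' (half_pos hr0) p, hg.mul_left _, fun w => (Real.exp_pos _).le,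
      fun n => by have := hg0 n; positivity, fun w n => ?_⟩
    calc |∑ c, comp K (T n) x w a c * K w z c b| ≤ ∑ c, |comp K (T n) x w a c * K w z c b| := Finset.abs_sum_le_sum_abs _ _
      _ ≤ ∑ _c : Fib d, ((Fintype.card (Fib d) : ℝ) * (CK * g n) * Zl (d + 1) (r - r / 2)) * Real.exp (-(r / 2) * l1 (w - p)) * CK :=
          Finset.sum_le_sum fun c _ => by
            rw [abs_mul]
            refine mul_le_mul ((hKT n x w a c).trans ?_) ((hK w z c b).trans ?_) (abs_nonneg _) (by have := hg0 n; positivity)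
            · rw [mul_add, Real.exp_add]
              have h1 : Real.exp (-(r / 2) * l1 (x - p)) ≤ 1 := by
                rw [Real.exp_le_one_iff]; exact mul_nonpos_of_nonpos_of_nonneg (neg_nonpos.2 (half_pos hr0).le) (l1_nonneg _)
              have h0 : 0 ≤ (Fintype.card (Fib d) : ℝ) * (CK * g n) * Zl (d + 1) (r - r / 2) := by have := hg0 n; positivity
              calc (Fintype.card (Fib d) : ℝ) * (CK * g n) * Zl (d + 1) (r - r / 2) * (Real.exp (-(r / 2) * l1 (x - p)) * Real.exp (-(r / 2) * l1 (w - p)))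
                  ≤ (Fintype.card (Fib d) : ℝ) * (CK * g n) * Zl (d + 1) (r - r / 2) * (1 * Real.exp (-(r / 2) * l1 (w - p))) :=
                    mul_le_mul_of_nonneg_left (mul_le_mul_of_nonneg_right h1 (Real.exp_pos _).le) h0
                _ = _ := by rw [one_mul]
            · have h1 : Real.exp (-δK * l1 (w - z)) ≤ 1 := by
                rw [Real.exp_le_one_iff]; exact mul_nonpos_of_nonpos_of_nonneg (neg_nonpos.2 hδK.le) (l1_nonneg _)
              calc CK * Real.exp (-δK * l1 (w - z)) ≤ CK * 1 := mul_le_mul_of_nonneg_left h1 hCK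
                _ = CK := mul_one _
      _ = Real.exp (-(r / 2) * l1 (w - p))
          * (((Fintype.card (Fib d) : ℝ) * ((Fintype.card (Fib d) : ℝ) * CK * Zl (d + 1) (r - r / 2)) * CK) * g n) := by
          rw [Finset.sum_const, Finset.card_univ, nsmul_eq_mul]; ring
  have hs2 : ∀ w c, Summable fun n => comp K (T n) x w a c * K w z c b := fun w c => by
    refine Summable.of_norm_bounded ((hg.mul_left ((Fintype.card (Fib d) : ℝ) * CK * Zl (d + 1) (r - r / 2))).mul_right |K w z c b|)
      fun n => ?_
    rw [Real.norm_eq_abs, abs_mul]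
    refine mul_le_mul_of_nonneg_right ((hKT n x w a c).trans ?_) (abs_nonneg _)
    have h1 : Real.exp (-(r / 2) * (l1 (x - p) + l1 (w - p))) ≤ 1 := by
      rw [Real.exp_le_one_iff]
      exact mul_nonpos_of_nonpos_of_nonneg (neg_nonpos.2 (half_pos hr0).le) (add_nonneg (l1_nonneg _) (l1_nonneg _))
    have h0 : 0 ≤ (Fintype.card (Fib d) : ℝ) * (CK * g n) * Zl (d + 1) (r - r / 2) := by have := hg0 n; positivity
    calc (Fintype.card (Fib d) : ℝ) * (CK * g n) * Zl (d + 1) (r - r / 2) * Real.exp (-(r / 2) * (l1 (x - p) + l1 (w - p)))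
        ≤ (Fintype.card (Fib d) : ℝ) * (CK * g n) * Zl (d + 1) (r - r / 2) * 1 := mul_le_mul_of_nonneg_left h1 h0
      _ = (Fintype.card (Fib d) : ℝ) * CK * Zl (d + 1) (r - r / 2) * g n := by ring
  symm
  calc comp (comp K (fun x z a b => ∑' n, T n x z a b)) K x z a b
      = ∑' w, ∑ c, (∑' v, ∑ f, K x v a f * (∑' n, T n v w f c)) * K w z c b := rfl
    _ = ∑' w, ∑ c, (∑' n, comp K (T n) x w a c) * K w z c b := by simp only [inner]
    _ = ∑' w, ∑' n, ∑ c, comp K (T n) x w a c * K w z c b := by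
        refine tsum_congr fun w => ?_
        rw [Summable.tsum_finsetSum (fun c _ => hs2 w c)]
        exact Finset.sum_congr rfl fun c _ => tsum_mul_right.symm
    _ = ∑' n, ∑' w, ∑ c, comp K (T n) x w a c * K w z c b := tsum_comm_of_prodBound hPB2
    _ = ∑' n, comp (comp K (T n)) K x z a b := rfl

end Family

/-! ## §2 Period shifts: `dper` forgets them, invariant factors commute with them -/

omit [∀ μ, NeZero (M μ)] in
/-- [folklore] `dper M` of a kernel shifted by a period vector `M∘k` is `dper M` of the kernel (re-index the period sum). -/
theorem dper_shiftK_per (X : MKer (d + 1) (Fib d)) (k : Site (d + 1)) :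
    dper M (shiftK (fun i => (M i : ℤ) * k i) X) = dper M X := by
  funext x z a b
  simp only [dper_apply, shiftK_eq_translate, translate_translate]
  exact (Equiv.addRight k).tsum_eq fun m => X (translate M x m) (translate M z m) a b

omit [∀ μ, NeZero (M μ)] in
/-- [folklore] an invariant left factor commutes with a shift of the right factor: `K ∘ shiftK v U = shiftK v (K ∘ U)` when `shiftK v K = K`. -/
theorem comp_shiftK_of_inv {K : MKer (d + 1) (Fib d)} {v : Site (d + 1)} (hK : shiftK v K = K) (U : MKer (d + 1) (Fib d)) :
    comp K (shiftK v U) = shiftK v (comp K U) := by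
  rw [← comp_shiftK, hK]

omit [∀ μ, NeZero (M μ)] in
/-- [folklore] a shifted left factor: `shiftK v B ∘ V = shiftK v (B ∘ shiftK (−v) V)`. -/
theorem comp_shiftK_left' (B V : MKer (d + 1) (Fib d)) (v : Site (d + 1)) :
    comp (shiftK v B) V = shiftK v (comp B (shiftK (-v) V)) := by
  have h : shiftK v (shiftK (-v) V) = V := by
    funext x z a b; simp only [shiftK, add_neg_cancel_right]
  conv_lhs => rw [← h]
  exact comp_shiftK v B (shiftK (-v) V)

omit [∀ μ, NeZero (M μ)] in
/-- [folklore] the shift by `−M∘n` read through `translate`: `shiftK (−M∘n) X x z = X (x + M∘(−n)) (z + M∘(−n))`. -/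
theorem shiftK_neg_per_apply (X : MKer (d + 1) (Fib d)) (n x z : Site (d + 1)) (a b : Fib d) :
    shiftK (-(fun i => (M i : ℤ) * n i)) X x z a b = X (translate M x (-n)) (translate M z (-n)) a b := by
  have e : (-(fun i => (M i : ℤ) * n i)) = fun i => (M i : ℤ) * (-n) i := by
    funext i; simp only [Pi.neg_apply, mul_neg]
  rw [e, shiftK_eq_translate]

/-! ## §3 `M = N·M′`: the bond moved by a coarse period is the kernel shifted by the fine period -/

section Cov

variable {N : ℕ} [NeZero N] {M' : Fin (d + 1) → ℕ}

omit [∀ μ, NeZero (M μ)] [NeZero N] in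
/-- [folklore] `N • (M′∘n) = M∘n` when `M = N·M′`. -/
theorem nsmul_per (hM : ∀ i, M i = N * M' i) (n : Site (d + 1)) :
    (N : ℤ) • (fun i => (M' i : ℤ) * n i) = fun i => (M i : ℤ) * n i := by
  funext i
  simp only [Pi.smul_apply, smul_eq_mul, hM i, Nat.cast_mul]
  ring

omit [∀ μ, NeZero (M μ)] [NeZero N] in
/-- [folklore] `−N • (M′∘n) = M∘(−n)` when `M = N·M′`. -/
theorem neg_nsmul_per (hM : ∀ i, M i = N * M' i) (n : Site (d + 1)) :
    -((N : ℤ) • (fun i => (M' i : ℤ) * n i)) = fun i => (M i : ℤ) * (-n) i := by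
  funext i
  simp only [Pi.neg_apply, Pi.smul_apply, smul_eq_mul, hM i, Nat.cast_mul]
  ring

omit [∀ μ, NeZero (M μ)] [NeZero N] in
/-- [folklore] a fine-period-invariant kernel is fixed by the shift `−N•(M′∘n) = M∘(−n)`. -/
theorem shiftK_per_of_inv (hM : ∀ i, M i = N * M' i) {K : MKer (d + 1) (Fib d)}
    (hKinv : ∀ (m x z : Site (d + 1)) (a b : Fib d), K (translate M x m) (translate M z m) a b = K x z a b) (n : Site (d + 1)) :
    shiftK (-((N : ℤ) • fun i => (M' i : ℤ) * n i)) K = K := by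
  rw [nsmul_per M hM]
  have e : (-(fun i => (M i : ℤ) * n i)) = fun i => (M i : ℤ) * (-n) i := by
    funext i; simp only [Pi.neg_apply, mul_neg]
  rw [e]
  exact shiftK_of_translate_inv M hKinv (-n)

omit [∀ μ, NeZero (M μ)] [NeZero N] in
/-- [folklore] a FINE-bond table family that is period covariant (`hSt`) obeys the two-family covariance shape of
`SecondOrderResponse.vertexOfK_shiftK_translate₂` at `t := M′∘n`: `S κ (u + N•t) = shiftK (−N•t) (S κ u)`. -/
theorem table_per_of_cov (hM : ∀ i, M i = N * M' i) {S : Fin (d + 1) → Site (d + 1) → MKer (d + 1) (Fib d)}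
    (hSt : ∀ (κ : Fin (d + 1)) (u m x z : Site (d + 1)) (a b : Fib d), S κ (translate M u m) (translate M x m) (translate M z m) a b = S κ u x z a b)
    (n : Site (d + 1)) (κ : Fin (d + 1)) (u : Site (d + 1)) :
    S κ (u + (N : ℤ) • fun i => (M' i : ℤ) * n i) = shiftK (-((N : ℤ) • fun i => (M' i : ℤ) * n i)) (S κ u) := by
  rw [nsmul_per M hM]
  funext x z a b
  rw [shiftK_neg_per_apply M]
  have hu : (u + fun i => (M i : ℤ) * n i) = translate M u n := (translate_eq_add M u n).symm
  have hx : translate M (translate M x (-n)) n = x := by rw [translate_translate, neg_add_cancel, CombHId2Product.translate_zero_right]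
  have hz : translate M (translate M z (-n)) n = z := by rw [translate_translate, neg_add_cancel, CombHId2Product.translate_zero_right]
  rw [hu, ← hSt κ u n (translate M x (-n)) (translate M z (-n)) a b, hx, hz]

omit [∀ μ, NeZero (M μ)] [NeZero N] in
/-- [folklore] a COARSE-bond table family that is `M′`-period covariant (`hMt`) obeys `Mt ρ (w + t) = shiftK (−N•t) (Mt ρ w)` at `t := M′∘n`. -/
theorem ctable_per_of_cov (hM : ∀ i, M i = N * M' i) {Mt : Fin (d + 1) → Site (d + 1) → MKer (d + 1) (Fib d)}
    (hMt : ∀ (ρ : Fin (d + 1)) (w m x z : Site (d + 1)) (a b : Fib d),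
      Mt ρ (translate M' w m) (translate M x m) (translate M z m) a b = Mt ρ w x z a b)
    (n : Site (d + 1)) (ρ : Fin (d + 1)) (w : Site (d + 1)) :
    Mt ρ (w + fun i => (M' i : ℤ) * n i) = shiftK (-((N : ℤ) • fun i => (M' i : ℤ) * n i)) (Mt ρ w) := by
  rw [nsmul_per M hM]
  funext x z a b
  rw [shiftK_neg_per_apply M]
  have hw : (w + fun i => (M' i : ℤ) * n i) = translate M' w n := (translate_eq_add M' w n).symm
  have hx : translate M (translate M x (-n)) n = x := by rw [translate_translate, neg_add_cancel, CombHId2Product.translate_zero_right]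
  have hz : translate M (translate M z (-n)) n = z := by rw [translate_translate, neg_add_cancel, CombHId2Product.translate_zero_right]
  rw [hw, ← hMt ρ w n (translate M x (-n)) (translate M z (-n)) a b, hx, hz]

omit [∀ μ, NeZero (M μ)] in
/-- [folklore] **PERIOD COVARIANCE OF `dM` IN THE BOND** (`M = N·M′`; `K` fine-period invariant; `S`, `Mt` period covariant):
`dM K N S Mt μ (y + M′∘n) = shiftK (M∘(−n)) (dM K N S Mt μ y)` (`= dM … μ y` read at `· − M∘n`). -/
theorem dM_translate_per (hM : ∀ i, M i = N * M' i) {K : MKer (d + 1) (Fib d)}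
    (hKinv : ∀ (m x z : Site (d + 1)) (a b : Fib d), K (translate M x m) (translate M z m) a b = K x z a b)
    {S Mt : Fin (d + 1) → Site (d + 1) → MKer (d + 1) (Fib d)}
    (hSt : ∀ (κ : Fin (d + 1)) (u m x z : Site (d + 1)) (a b : Fib d), S κ (translate M u m) (translate M x m) (translate M z m) a b = S κ u x z a b)
    (hMt : ∀ (ρ : Fin (d + 1)) (w m x z : Site (d + 1)) (a b : Fib d),
      Mt ρ (translate M' w m) (translate M x m) (translate M z m) a b = Mt ρ w x z a b)
    (μ : Fin (d + 1)) (y n : Site (d + 1)) :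
    dM K N S Mt μ (translate M' y n) = shiftK (fun i => (M i : ℤ) * (-n) i) (dM K N S Mt μ y) := by
  have hK' := shiftK_per_of_inv M hM hKinv n
  rw [translate_eq_add M' y n, ← neg_nsmul_per M hM n]
  funext x z a b
  rw [dM_apply]
  conv_lhs => rw [← hK']
  rw [vertexOfK_shiftK_translate₂ K (table_per_of_cov M hM hSt n) μ y,
    vertexOfM_shiftK_translate₂ K (fun ρ w => ctable_per_of_cov M hM hMt n ρ w) μ y]
  rfl

omit [∀ μ, NeZero (M μ)] in
/-- [folklore] **PERIOD COVARIANCE OF `K2OfK` IN THE BOND**: `K2OfK K N S Mt ν (y′ + M′∘n) = shiftK (M∘(−n)) (K2OfK K N S Mt ν y′)`. -/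
theorem K2OfK_translate_per (hM : ∀ i, M i = N * M' i) {K : MKer (d + 1) (Fib d)}
    (hKinv : ∀ (m x z : Site (d + 1)) (a b : Fib d), K (translate M x m) (translate M z m) a b = K x z a b)
    {S Mt : Fin (d + 1) → Site (d + 1) → MKer (d + 1) (Fib d)}
    (hSt : ∀ (κ : Fin (d + 1)) (u m x z : Site (d + 1)) (a b : Fib d), S κ (translate M u m) (translate M x m) (translate M z m) a b = S κ u x z a b)
    (hMt : ∀ (ρ : Fin (d + 1)) (w m x z : Site (d + 1)) (a b : Fib d),
      Mt ρ (translate M' w m) (translate M x m) (translate M z m) a b = Mt ρ w x z a b)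
    (ν : Fin (d + 1)) (y' n : Site (d + 1)) :
    K2OfK K N S Mt ν (translate M' y' n) = shiftK (fun i => (M i : ℤ) * (-n) i) (K2OfK K N S Mt ν y') := by
  have hK' : shiftK (fun i => (M i : ℤ) * (-n) i) K = K := shiftK_of_translate_inv M hKinv (-n)
  have hV := dM_translate_per M hM hKinv hSt hMt ν y' n
  have hc : comp (comp K (shiftK (fun i => (M i : ℤ) * (-n) i) (dM K N S Mt ν y'))) K
      = shiftK (fun i => (M i : ℤ) * (-n) i) (comp (comp K (dM K N S Mt ν y')) K) := by
    conv_rhs => rw [← comp_shiftK, ← comp_shiftK, hK']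
  funext x z a b
  simp only [K2OfK, shiftK]
  rw [hV, hc]
  rfl

end Cov

end Summit.QuantumFields.BalabanUV.Beta.CombHId2CopySum

end
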